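/-
Copyright (c) 2026 the pub-hodgecm-mathlib formalisation cell (harness21).  Prover seat hodgecm-mathlib-K2Liu-p08 (g6), Track B «K2-LIT»,
#184♮ = hLiu418 = `stmt-HodgeConjecture-24832`; #42S BLOCK D, row D-2, (σ-A) mini-road (LEAD F0P6-plan (g15) RULING M-160f ∕ BATCH #238; (σ-A) road desk
K2Liu-p25 (g3) WORDs #29, #35, #43), brick (an-3c) §3a: THE LOCAL SOCKET PACKAGE — from the stage letters to the five letters `hρ hG hq hZ hcone` of
★ p864553 `K2LiuLocalSWSeamOfRecordGuarded.hV_faces_of_coneWord_of_dead` at ONE place.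
THEOREMS ONLY (no `def`, no `instance`, no `notation`, no named-fact hypothesis, no `sorry`, default heartbeats).
-/
import Summits.HodgeConjecture.HodgeConjecture.Theorems.K2LiuConeWordIntegrabilityZeta   -- ★ p864678 (I1) `integrable_vectorAlongGraph` (+ ★ p864636 (I2) `integrable_frameDensity`)
import Summits.HodgeConjecture.HodgeConjecture.Theorems.K2LiuStageFunctionalConeWord     -- ★ p864562 `coneWord_of_stageLetters`, `ae_prod_fst_notMem_of_null`
import Summits.HodgeConjecture.HodgeConjecture.Theorems.K2LiuAdaptedFrameOfMinor          -- ★ p864435 `frame_glue_zero_dotProduct_apply_eq_zero`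
import HarnessLib

/-!
# Crux `HLiu418`, #42S BLOCK D, row D-2, (σ-A) brick (an-3c) §3a: THE CONE-WORD PACKAGE AT ONE PLACE — the stage letters (L1)–(L4), the cone
# measure's three clauses, the charts and the pointwise Witt letter GIVE the five socket letters `SFinite ρ`, `Integrable G ρ`, `Measurable q`,
# `∀ᵐ z ∂ρ, q z = 0 ∨ R (q z)`, `∀ x, N₂val x = γ′ · ∫ ψ(x · q z) · G z dρ(z)` on the carrier `ρ := σ ⊗ μ^{ι₂}`

Cell `hodgecm-mathlib`, crux item hLiu418 = `stmt-HodgeConjecture-24832`; squad K2 ∕ K2Liu; prover K2Liu-p08 (g6).  Lane `--supports stmt-HodgeConjecture-24832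
--as helper` (count-neutral helper; closes no socket).

WHY.  The D-2 socket of record ★ p864553 `hV_faces_of_coneWord_of_dead` takes, at every dead bad place, a carrier `(Z v, ρ)` with `SFinite ρ`, a density `G`
(`Integrable G ρ`), a phase `q` (`Measurable q`), a scalar `γ`, the SUPPORT LETTER `hZ : ∀ᵐ z ∂ρ, q z = 0 ∨ (−q z·a⁻¹, θ)_v = 1` and the CONE WORD
`hcone : ∀ x, N₂val x = γ · ∫ ψ_v(x · q z) · G z dρ`.  ★ p864562 `coneWord_of_stageLetters` produces the cone word at ONE `x` from the stage letters with the two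
`L¹` letters (I1), (I2) BY VALUE; ★ p864678 ∕ ★ p864636 pay (I1), (I2) from the vertex law of `σ` and the charts.  THIS FILE is the by-name junction of the
three: it fixes the carrier `Z := F^{ι₁′} × F^{ι₂}`, `ρ := σ ⊗ μ^{ι₂}` (`σ` = ★ p864508 (an-1) B's null-cone measure, by value through its clauses
`IsFiniteMeasureOnCompacts σ`, `σ{0} = 0`, `σ{Q ≠ 0} = 0`, vertex law), the witnesses `G(s,b) := c_κ·|det A_s|·G₀(A_s(0 ⊔ b) ⊔ s)`,
`q(s,b) := q_f(A_s(0 ⊔ b) ⊔ s)`, `γ′ := c_E·c_F·γ` (named through defining letters `hGdef hqdef hγdef`, so the #42S frame instantiates them by `rfl`), and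
delivers ALL FIVE socket letters at once:
* `SFinite ρ` — `σ` is finite on compacts on the σ-compact group `F^{ι₁′}`;
* `Integrable G ρ` — ★ (I2) at `Θ := G₀`;
* `Measurable q` — `q_f` continuous, the frame map `(s,b) ↦ A_s(0 ⊔ b)` measurable (chart letter `hAm`), gluing continuous;
* `hZ` — the two `σ`-null sets `{0}`, `{Q ≠ 0}` lift to `ρ` (★ `ae_prod_fst_notMem_of_null`); off them `t := A_s(0 ⊔ b)` is orthogonal to the graph
  (`t ⬝ᵥ Z_s ζ = 0` for all `ζ`, ★ p864435 `frame_glue_zero_dotProduct_apply_eq_zero` from the adaptation letter `hA`), so the POINTWISE WITT LETTER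
  `hWitt : s ≠ 0 → Q s = 0 → (∀ ζ, t ⬝ᵥ Z_s ζ = 0) → q_f(t ⊔ s) = 0 ∨ R(q_f(t ⊔ s))` applies (by value here; its payer is ★ p864316 [A4-alg] §3
  `hilbertSymbol_neg_self_pairing_div_det_eq_one` through the charts' coordinate dictionary, `R y :↔ (−y·a⁻¹, θ)_v = 1`);
* `hcone` at every `x` — ★ p864562 with (I1) := ★ `integrable_vectorAlongGraph` (the vector `V_x ∈ 𝒮(F^ι)` is continuous) and (I2) := ★ `integrable_frameDensity`
  at `Θ_x`, then the defining letters.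
Also `vertexLaw_real_of_nnreal` converts ★ p864508's clause (3) (`ℝ≥0`-cast constant) into the `ℝ` form (I1)/(I2) take.
BY VALUE and paid elsewhere: the telescope (L1)–(L4) ((L1)(L2): ★ `chainValues_half_of_placeLetter` (g) + ★ `stageA_half_of_word` + ★ p864508 clause (1) + ★ [A1]
p864240 + ★ [A1-ζ] p864336 + ★ (α′) p864614; (L3): (W-w₂)@point F0P2-p07 §3 + ★ p864180 `coe_boxEquivSB_fourierOpPi_refl_apply_glue`; (L4): ★ Rao
`coe_unipOpPi_apply`), the charts `Zm hZc hZlow A hA hres hAm hdetm` ((an-3c-charts) FILE 2, K2Liu-p12 (g6)), `hWitt`.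
HONEST LABEL.  `HC_CM` is proved only modulo the 7 printed citations (2 remaining named inputs: hLiu418 = `stmt-HodgeConjecture-24832`,
h413 = `stmt-HodgeConjecture-24833`) until rung 0 closes; count-neutral helper, closes no socket.

## References
* [KudlaRallis1994] S. Kudla, S. Rallis, *A regularized Siegel–Weil formula: the first term identity*, Ann. of Math. 140 (1994), §2 (2.10)–(2.12), §5 (5.3)–(5.6).
* [Weil1965] A. Weil, *Sur la formule de Siegel dans la théorie des groupes classiques*, Acta Math. 113 (1965), Chap. III n° 36–37 Prop. 6.
* [MoeglinVignerasWaldspurger1987] C. Mœglin, M.-F. Vignéras, J.-L. Waldspurger, LNM 1291 (1987), Chap. 2 II.6.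
-/

set_option autoImplicit false
set_option linter.dupNamespace false -- the mandated namespace repeats `HodgeConjecture.HodgeConjecture`

noncomputable section

open MeasureTheory Set Filter Function
open scoped Matrix NNReal ENNReal
open Literature.NumberTheory.Automorphic
open Literature.NumberTheory.GaloisRepresentations Literature.NumberTheory.GaloisRepresentations.IsNonarchimedeanLocalField
open Literature.RepresentationTheory.HeisenbergGroup
open Literature.NumberTheory.Weil1965.SplitPlace (level)
open Summit.HodgeConjecture.HodgeConjecture.Cruxes.HLiu418
open Summit.HodgeConjecture.HodgeConjecture.Cruxes.HLiu418.K2LiuConeWordIntegrability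
open Summit.HodgeConjecture.HodgeConjecture.Cruxes.HLiu418.K2LiuConeWordIntegrabilityZeta
open Summit.HodgeConjecture.HodgeConjecture.Cruxes.HLiu418.K2LiuStageFunctionalConeWord
open Summit.HodgeConjecture.HodgeConjecture.Cruxes.HLiu418.K2LiuAdaptedFrameOfMinor

namespace Summit.HodgeConjecture.HodgeConjecture.Cruxes.HLiu418.K2LiuConeWordPackage

/-! ## §0 The vertex law in `ℝ` form -/

section Law

variable {F : Type*} [Field F] [ValuativeRel F] [TopologicalSpace F] [IsNonarchimedeanLocalField F] [MeasurableSpace F]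
  {ι₁' : Type*} [Fintype ι₁']

omit [Fintype ι₁'] in
/-- ★ p864508 `exists_nullConeMeasure` clause (3) (the `ℝ≥0`-cast constant `(q⁻¹)^{card ι}·q²`) in the `ℝ` form the `L¹` letters (I1), (I2) take
(`(q^{card ι})⁻¹·q²`). [cite: KudlaRallis1994, §5 (5.3)–(5.6)] -/
theorem vertexLaw_real_of_nnreal (σ : Measure (ι₁' → F)) (c : ℕ)
    (hlaw : ∀ n : ℤ, σ.real (piPrimePowBall F ι₁' (n + 1)) =
      (((residueFieldCard F : ℝ≥0)⁻¹ ^ c * (residueFieldCard F : ℝ≥0) ^ 2 : ℝ≥0) : ℝ) * σ.real (piPrimePowBall F ι₁' n)) :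
    ∀ n : ℤ, σ.real (piPrimePowBall F ι₁' (n + 1)) =
      (((residueFieldCard F : ℝ) ^ c)⁻¹ * (residueFieldCard F : ℝ) ^ 2) * σ.real (piPrimePowBall F ι₁' n) := by
  intro n
  rw [hlaw n, NNReal.coe_mul, NNReal.coe_pow, NNReal.coe_pow, NNReal.coe_inv, NNReal.coe_natCast, inv_pow]

end Law

/-! ## §1 The package -/

section Package

variable {F : Type*} [Field F] [ValuativeRel F] [TopologicalSpace F] [IsNonarchimedeanLocalField F]
  [MeasurableSpace F] [BorelSpace F] (μ : Measure F) [μ.IsAddHaarMeasure]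
  {ψ : AddChar F Circle} (hψ : ψ.IsContinuousNontrivial) {m : ℤ} (hm : ψ.HasConductorExp m)
  {κ ι₂ ι₁ ι₁' ι : Type*} [Fintype κ] [Fintype ι₂] [Fintype ι₁] [Fintype ι₁'] [Fintype ι] [Nonempty ι₁']
  (e : ι₁ ⊕ ι₁' ≃ ι) (eA : κ ⊕ ι₂ ≃ ι₁)

include hψ hm in
/-- **THE CONE-WORD PACKAGE AT ONE PLACE.**  `μ` Haar on the local field `F`, `ψ` continuous non-trivial of conductor exponent `m`; the two-block model
`F^ι = F^{ι₁} ⊔ F^{ι₁′}` (`e`), the `ζ`-splitting `eA : κ ⊕ ι₂ ≃ ι₁`, `card κ + 2 < card ι₁′`.  BY VALUE: the cone measure `σ` (finite on compacts, `σ{0} = 0`,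
`σ{Q ≠ 0} = 0`, vertex law), the charts (`Z_s` jointly continuous with the chart-free lower bound `hZlow`, frames `A_s` adapted to `Z_s` off the vertex, box-fibre
letter `hres`, measurability letters `hAm hdetm`), the telescope (L1)–(L4) at every `x` (vectors `V_x ∈ 𝒮(F^ι)`, positions `Θ_x ∈ 𝒮(F^ι)`, phase split through
`q_f` continuous and `G₀ ∈ 𝒮(F^ι)`), the pointwise Witt letter `hWitt` for a predicate `R` on phase values, and NAMES `G q γ′` with their defining letters.
THEN, on `ρ := σ ⊗ μ^{ι₂}`: `SFinite ρ`, `Integrable G ρ`, `Measurable q`, `∀ᵐ z ∂ρ, q z = 0 ∨ R (q z)`, and `∀ x, N₂val x = γ′ · ∫ ψ(x · q z) · G z dρ(z)` —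
the five letters `hρ hG hq hZ hcone` of ★ p864553 `hV_faces_of_coneWord_of_dead` at one place (`R y :↔ (−y·a⁻¹, θ)_v = 1`).
[cite: KudlaRallis1994, §2 (2.10)–(2.12)] [cite: Weil1965, Chap. III n° 36–37 Prop. 6] [cite: MoeglinVignerasWaldspurger1987, Chap. 2 II.6] -/
theorem conePackage_of_stageLetters
    -- the cone measure ((an-1) FILE B clauses, by value)
    (σ : Measure (ι₁' → F)) [IsFiniteMeasureOnCompacts σ] (hσ0 : σ {0} = 0)
    (Qc : (ι₁' → F) → F) (hσQ : σ {s | Qc s ≠ 0} = 0)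
    (hlaw : ∀ n : ℤ, σ.real (piPrimePowBall F ι₁' (n + 1)) =
      (((residueFieldCard F : ℝ) ^ Fintype.card ι₁')⁻¹ * (residueFieldCard F : ℝ) ^ 2) * σ.real (piPrimePowBall F ι₁' n))
    -- the charts ((an-3c-charts) FILE 2 letters, by value)
    (Zm : (ι₁' → F) → ((κ → F) →ₗ[F] (ι₁ → F))) (hZc : Continuous fun p : (ι₁' → F) × (κ → F) => Zm p.1 p.2) (c₀ : ℤ)
    (hZlow : ∀ s : ι₁' → F, s ≠ 0 → ∀ (N : ℤ) (ζ : κ → F), Zm s ζ ∈ piPrimePowBall F ι₁ N → ζ ∈ piPrimePowBall F κ (N - level s - c₀))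
    (A : (ι₁' → F) → ((ι₁ → F) ≃ₗ[F] (ι₁ → F)))
    (hA : ∀ s : ι₁' → F, s ≠ 0 → ∀ (t : ι₁ → F) (ζ : κ → F), A s t ⬝ᵥ Zm s ζ = resL eA t ⬝ᵥ ζ)
    (hres : ∀ (s : ι₁' → F) (b : ι₂ → F) (N' : ℤ), A s (glue eA 0 b) ∈ piPrimePowBall F ι₁ N' → b ∈ piPrimePowBall F ι₂ N')
    (hAm : Measurable fun p : (ι₁' → F) × (ι₂ → F) => A p.1 (glue eA 0 p.2))
    (hdetm : Measurable fun s : ι₁' → F => normAbs F (LinearMap.det (A s : (ι₁ → F) →ₗ[F] (ι₁ → F))))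
    (hnum : Fintype.card κ + 2 < Fintype.card ι₁')
    -- the telescope (L1)–(L4) at every `x` (by value)
    (N₂val : F → ℂ) (N₁ : F → (κ → F) → ℂ) (V Θ : F → SchwartzBruhat (ι → F))
    (qf : (ι → F) → F) (hqf : Continuous qf) (G₀ : SchwartzBruhat (ι → F)) (cE cF γ : ℂ)
    (hL1 : ∀ x, N₂val x = cE * ∫ ζ, N₁ x ζ ∂(Measure.pi fun _ : κ => μ))
    (hL2 : ∀ (x : F) (ζ : κ → F), N₁ x ζ = cF * ∫ s, (V x : (ι → F) → ℂ) (glue e (Zm s ζ) s) ∂σ)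
    (hL3 : ∀ (x : F) (q₁ : ι₁ → F) (q₂ : ι₁' → F),
      (V x : (ι → F) → ℂ) (glue e q₁ q₂) = γ * ∫ t, ((ψ (t ⬝ᵥ q₁) : Circle) : ℂ) * (Θ x : (ι → F) → ℂ) (glue e t q₂) ∂(Measure.pi fun _ : ι₁ => μ))
    (hL4 : ∀ (x : F) (u : ι → F), (Θ x : (ι → F) → ℂ) u = ((ψ (x * qf u) : Circle) : ℂ) * (G₀ : (ι → F) → ℂ) u)
    -- the pointwise Witt letter on the cone (by value)
    (R : F → Prop)
    (hWitt : ∀ s : ι₁' → F, s ≠ 0 → Qc s = 0 → ∀ t : ι₁ → F, (∀ ζ : κ → F, t ⬝ᵥ Zm s ζ = 0) →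
      qf (glue e t s) = 0 ∨ R (qf (glue e t s)))
    -- the package names and their defining letters
    (G : (ι₁' → F) × (ι₂ → F) → ℂ) (q : (ι₁' → F) × (ι₂ → F) → F) (γ' : ℂ)
    (hGdef : ∀ p : (ι₁' → F) × (ι₂ → F), G p =
      (piSelfDualConst F κ (Measure.pi fun _ : κ => μ) m : ℂ) * (normAbs F (LinearMap.det (A p.1 : (ι₁ → F) →ₗ[F] (ι₁ → F))) : ℂ) *
        (G₀ : (ι → F) → ℂ) (glue e (A p.1 (glue eA 0 p.2)) p.1))
    (hqdef : ∀ p : (ι₁' → F) × (ι₂ → F), q p = qf (glue e (A p.1 (glue eA 0 p.2)) p.1))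
    (hγdef : γ' = cE * cF * γ) :
    SFinite (σ.prod (Measure.pi fun _ : ι₂ => μ)) ∧
    Integrable G (σ.prod (Measure.pi fun _ : ι₂ => μ)) ∧
    Measurable q ∧
    (∀ᵐ z ∂(σ.prod (Measure.pi fun _ : ι₂ => μ)), q z = 0 ∨ R (q z)) ∧
    ∀ x : F, N₂val x = γ' * ∫ z, ((ψ (x * q z) : Circle) : ℂ) * G z ∂(σ.prod (Measure.pi fun _ : ι₂ => μ)) := by
  haveI : T2Space F := (isLocalField F).toT2Space
  haveI : SecondCountableTopology F := secondCountableTopology_localField F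
  haveI : LocallyCompactSpace F := (isLocalField F).toLocallyCompactSpace
  haveI : SigmaFinite σ := inferInstance
  refine ⟨inferInstance, ?_, ?_, ?_, fun x => ?_⟩
  · -- `Integrable G ρ`: ★ (I2) at `Θ := G₀`, times the constant `c_κ`
    have hI := (integrable_frameDensity μ e eA hψ hm σ hσ0 hlaw Zm c₀ hZlow A hA hres hAm hdetm hnum G₀).const_mul
      (piSelfDualConst F κ (Measure.pi fun _ : κ => μ) m : ℂ)
    refine hI.congr (Eventually.of_forall fun p => ?_)
    simp only [hGdef, mul_assoc]
  · -- `Measurable q`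
    have hq : q = fun p : (ι₁' → F) × (ι₂ → F) => qf (glue e (A p.1 (glue eA 0 p.2)) p.1) := funext hqdef
    rw [hq]
    exact hqf.measurable.comp ((continuous_glue e).measurable.comp (hAm.prodMk measurable_fst))
  · -- `hZ`: the two `σ`-null sets lift to `ρ`; off them the frame point is orthogonal to the graph, and Witt applies
    filter_upwards [ae_prod_fst_notMem_of_null σ (Measure.pi fun _ : ι₂ => μ) hσ0,
      ae_prod_fst_notMem_of_null σ (Measure.pi fun _ : ι₂ => μ) hσQ] with p h0 hQ
    have hs : p.1 ≠ 0 := fun h => h0 (h ▸ mem_singleton _)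
    have hQ0 : Qc p.1 = 0 := by
      by_contra h
      exact hQ h
    rw [hqdef]
    exact hWitt p.1 hs hQ0 (A p.1 (glue eA 0 p.2)) fun ζ => frame_glue_zero_dotProduct_apply_eq_zero eA (Zm p.1) (hA p.1 hs) p.2 ζ
  · -- `hcone` at `x`: ★ p864562 with (I1) := ★ `integrable_vectorAlongGraph`, (I2) := ★ `integrable_frameDensity`
    have hI1 := integrable_vectorAlongGraph μ e hm σ hσ0 hlaw Zm hZc c₀ hZlow hnum (Θ x) (V x : (ι → F) → ℂ)
      (V x).2.1.continuous γ (hL3 x)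
    have hI2 := integrable_frameDensity μ e eA hψ hm σ hσ0 hlaw Zm c₀ hZlow A hA hres hAm hdetm hnum (Θ x)
    have hw := coneWord_of_stageLetters μ hψ hm e eA σ hσ0 Zm A hA x N₂val N₁ (fun y => (V y : (ι → F) → ℂ)) Θ qf
      (G₀ : (ι → F) → ℂ) cE cF γ (hL1 x) (hL2 x) (hL3 x) (hL4 x) hI1 hI2
    rw [hw, hγdef]
    congr 1
    refine integral_congr_ae (Eventually.of_forall fun p => ?_)
    simp only [hqdef, hGdef]

end Package

/-! ## §2 Totalising the package over the dead guard (the socket's data slots are unguarded) -/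

section Total

variable {F : Type*} [Field F] [MeasurableSpace F] {Z : Type*} [MeasurableSpace Z]

/-- **THE PACKAGE MADE TOTAL.**  ★ p864553 `hV_faces_of_coneWord_of_dead` binds the DATA `ρ G q γ` (with `SFinite ρ`, `Integrable G ρ`, `Measurable q`) at EVERY
tuple `(X,j,h,i,v)`, and the letters `hZ hcone` only under the dead guard.  If a guard `P` (dead ∧ non-split ∧ rank one …) yields the package of §1 for data
`ρ₀ h, G₀ h, q₀ h` (`h : P`), then the TOTAL data `ρ := if h : P then ρ₀ h else 0`, `G := if h : P then G₀ h else 0`, `q := if h : P then q₀ h else 0` satisfy the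
three unguarded slots outright (`SFinite 0`, `Integrable 0 0`, `measurable_const`) and the two guarded ones under `P` — the cut announced to K2E5-r02 (g8)'s guard note:
the `if` sits on the OUTPUTS, not on `σ`. [cite: KudlaRallis1994, §2 (2.10)–(2.12)] -/
theorem conePackage_total (P : Prop) [Decidable P] (ψ : AddChar F Circle) (R : F → Prop) (N₂val : F → ℂ) (γ' : ℂ)
    (ρ₀ : P → Measure Z) (G₀ : P → Z → ℂ) (q₀ : P → Z → F)
    (hpkg : ∀ h : P, SFinite (ρ₀ h) ∧ Integrable (G₀ h) (ρ₀ h) ∧ Measurable (q₀ h) ∧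
      (∀ᵐ z ∂(ρ₀ h), q₀ h z = 0 ∨ R (q₀ h z)) ∧ ∀ x : F, N₂val x = γ' * ∫ z, ((ψ (x * q₀ h z) : Circle) : ℂ) * G₀ h z ∂(ρ₀ h))
    (ρ : Measure Z) (G : Z → ℂ) (q : Z → F)
    (hρdef : ρ = if h : P then ρ₀ h else 0) (hGdef : G = if h : P then G₀ h else 0) (hqdef : q = if h : P then q₀ h else 0) :
    SFinite ρ ∧ Integrable G ρ ∧ Measurable q ∧
    (P → ∀ᵐ z ∂ρ, q z = 0 ∨ R (q z)) ∧
    (P → ∀ x : F, N₂val x = γ' * ∫ z, ((ψ (x * q z) : Circle) : ℂ) * G z ∂ρ) := by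
  by_cases h : P
  · obtain ⟨h1, h2, h3, h4, h5⟩ := hpkg h
    rw [dif_pos h] at hρdef hGdef hqdef
    subst hρdef hGdef hqdef
    exact ⟨h1, h2, h3, fun _ => h4, fun _ => h5⟩
  · rw [dif_neg h] at hρdef hGdef hqdef
    subst hρdef hGdef hqdef
    exact ⟨inferInstance, integrable_zero_measure, measurable_const, fun hP => absurd hP h, fun hP => absurd hP h⟩

end Total

end Summit.HodgeConjecture.HodgeConjecture.Cruxes.HLiu418.K2LiuConeWordPackage

end
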